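import Mathlib
import Summits.Ventures.PercRepro2.Defs
import Summits.Ventures.PercRepro2.Independence
import Summits.Ventures.PercRepro2.Harris
import Summits.Ventures.PercRepro2.Graph
import Summits.Ventures.PercRepro2.Events
import Summits.Ventures.PercRepro2.R21PinInduction
import Summits.Ventures.PercRepro2.R21BernAll
import Summits.Ventures.PercRepro2.R21NestedFrame

/-!
# The antipodal frame at the explored `o`-component: (R2-1) ⟸ (TOP-BERN-o) (PercRepro2, p2)

`r21Anti ends s y o u p F` (R21BernAll.lean) is the antipodal sum `M_F(p) = ∑_η B(p[F↦η], p[F↦!η])`, the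
tensor-Bernstein coefficient of the (R2-1) slack mixed on the edge set `F`; `M_∅ = 2^{|E|}·R`, and
along `g ∉ F`: `M_F(p) = (1 − w_g)² M_F(p[g↦0]) + 2 w_g (1 − w_g) M_{F∪{g}}(p) + w_g² M_F(p[g↦1])`
(`r21Anti_bernstein`).  (BERN-ALL) — `M_F ≥ 0` for EVERY `F` — is false from `n = 7` (NEG-209), but the
census says `M_F ≥ 0` for every `F` of unpinned edges at the EXPLORED `o`-COMPONENT `Λ_o` (0 / 80,000
at `|F| ≤ 4`, `n = 7–8` with pins; P2-G21-SINGLEEDGE.md §7).  Along an edge `e ∈ U(p) ∖ F` (`U(p)` the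
unpinned edges at `Λ_o`) the recursion stays inside this family, so by a downward induction on
`|U(p) ∖ F|` inside a strong pin induction everything reduces to the TOP coefficients `F = U(p)`:

  **(TOP-BERN-o)**  `0 ≤ M_{U(p)}(p)` for every admissible `p` and every mark assignment — the
  antipodal sum over ALL unpinned edges at `Λ_o` (the explored instances: `Λ_o` a pendant blob glued
  to complementary far-end sets in the two copies, summed over the complementary pairs).

`r21_of_top_bern_o`: **(R2-1) for every weight vector and every mark assignment ⟸ (TOP-BERN-o)**.
For `|U(p)| = 1` the top coefficient is `T_f` (the single-edge theorem, `r21_T_nonneg_of_single_edge`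
modulo the re-marked hypothesis); for `|U(p)| = 2` it is `M_{fg}` (record §7.2).  Its TERMWISE
strengthening (every complementary pair separately) is FALSE (record §7.5), so the sum is essential.

* `r21_of_top_bern_o` — **the frame**.
-/

namespace Summit.Ventures.PercRepro2

section BernOFrame

variable {V : Type*} {E : Type*} [Fintype E] [DecidableEq E]
  {R : Type*} [CommRing R] [LinearOrder R] [IsStrictOrderedRing R]


/-- **The frame: (R2-1) for every weight vector and every mark assignment ⟸ (TOP-BERN-o).** -/
theorem r21_of_top_bern_o (ends : E → Sym2 V)
    (hTop : ∀ p : E → R, IsProbVec p → ∀ s y o u : V, ∀ F : Finset E,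
      (∀ f ∈ F, (∃ v ∈ ends f, Conn ends (fun e => decide (p e = 1)) o v) ∧ p f ≠ 0 ∧ p f ≠ 1) → (∀ e, (∃ v ∈ ends e, Conn ends (fun e => decide (p e = 1)) o v) → p e ≠ 0 → p e ≠ 1 → e ∈ F) →
      0 ≤ r21Anti ends s y o u p F) :
    ∀ p : E → R, IsProbVec p → ∀ s y o u : V, 0 ≤ (prob p (connEvent ends s u ∩ clusterInEvent ends s {W : Set V | o ∈ W} ∩ (connEvent ends s y)ᶜ) + prob p (connEvent ends s u ∩ connEvent ends y o ∩ (connEvent ends s y)ᶜ) + prob p ((connEvent ends s y)ᶜ) * prob p (connEvent ends s u ∩ clusterInEvent ends s {W : Set V | o ∈ W}) - (prob p (connEvent ends s u ∩ (connEvent ends s y)ᶜ) * prob p (clusterInEvent ends s {W : Set V | o ∈ W}) + prob p (clusterInEvent ends s {W : Set V | o ∈ W} ∩ (connEvent ends s y)ᶜ) * prob p (connEvent ends s u) + prob p (connEvent ends y o ∩ (connEvent ends s y)ᶜ) * prob p (connEvent ends s u))) := by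
  classical
  suffices hΦ : ∀ p : E → R, IsProbVec p → (fun q : E → R => ∀ s y o u : V, ∀ F : Finset E, (∀ f ∈ F, (∃ v ∈ ends f, Conn ends (fun e => decide (q e = 1)) o v) ∧ q f ≠ 0 ∧ q f ≠ 1) → 0 ≤ r21Anti ends s y o u q F) p by
    intro p hp s y o u
    have h := hΦ p hp s y o u ∅ (by simp)
    rw [r21Anti_empty] at h
    have hpos : (0 : R) < (Fintype.card (E → Bool) : R) := by
      exact_mod_cast Fintype.card_pos
    have h2 : 0 ≤ r21Bil ends s y o u p p := by
      by_contra hneg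
      rw [not_le] at hneg
      have := mul_neg_of_pos_of_neg hpos hneg
      linarith
    unfold r21Bil at h2
    exact h2
  refine pin_strong_induction _ fun p hp ih => ?_
  intro s y o u
  have key : ∀ n : ℕ, ∀ F : Finset E, (∀ f ∈ F, (∃ v ∈ ends f, Conn ends (fun e => decide (p e = 1)) o v) ∧ p f ≠ 0 ∧ p f ≠ 1) →
      (Finset.univ.filter fun e => e ∉ F ∧ (∃ v ∈ ends e, Conn ends (fun e => decide (p e = 1)) o v) ∧ p e ≠ 0 ∧ p e ≠ 1).card = n →
      0 ≤ r21Anti ends s y o u p F := by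
    intro n
    induction n using Nat.strong_induction_on with
    | _ n ihn =>
      intro F hF hcard
      by_cases hfull : (∀ e, (∃ v ∈ ends e, Conn ends (fun e => decide (p e = 1)) o v) → p e ≠ 0 → p e ≠ 1 → e ∈ F)
      · exact hTop p hp s y o u F hF hfull
      · rw [not_forall] at hfull
        obtain ⟨e, he⟩ := hfull
        rw [Classical.not_imp, Classical.not_imp, Classical.not_imp] at he
        obtain ⟨heΛ, he0, he1, heF⟩ := he
        rw [r21Anti_bernstein ends s y o u p heF]
        have hA : 0 ≤ r21Anti ends s y o u (Function.update p e 0) F := by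
          refine ih (Function.update p e 0) (hp.update e le_rfl zero_le_one)
            (card_unpinned_update_lt p e he0 he1 0 (Or.inl rfl)) s y o u F fun f hf => ?_
          obtain ⟨hfΛ, hf0, hf1⟩ := hF f hf
          have hfe : f ≠ e := fun h => heF (h ▸ hf)
          rw [pinned_update_zero_eq p e he1]
          exact ⟨hfΛ, by rw [Function.update_of_ne hfe]; exact hf0, by rw [Function.update_of_ne hfe]; exact hf1⟩
        have hB : 0 ≤ r21Anti ends s y o u (Function.update p e 1) F := by
          refine ih (Function.update p e 1) (hp.update e zero_le_one le_rfl)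
            (card_unpinned_update_lt p e he0 he1 1 (Or.inr rfl)) s y o u F fun f hf => ?_
          obtain ⟨⟨v, hv, hvΛ⟩, hf0, hf1⟩ := hF f hf
          have hfe : f ≠ e := fun h => heF (h ▸ hf)
          exact ⟨⟨v, hv, conn_mono (pinned_le_update_one p e) hvΛ⟩, by rw [Function.update_of_ne hfe]; exact hf0,
            by rw [Function.update_of_ne hfe]; exact hf1⟩
        have hcard' : (Finset.univ.filter fun e' => e' ∉ insert e F ∧ (∃ v ∈ ends e', Conn ends (fun e => decide (p e = 1)) o v) ∧ p e' ≠ 0 ∧ p e' ≠ 1).card < n := by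
          rw [← hcard]
          refine Finset.card_lt_card ⟨fun x hx => ?_, fun hsub => ?_⟩
          · simp only [Finset.mem_filter, Finset.mem_univ, true_and, Finset.mem_insert, not_or] at hx ⊢
            exact ⟨hx.1.2, hx.2⟩
          · have := hsub (by simp [heF, heΛ, he0, he1] : e ∈ (Finset.univ.filter fun e' => e' ∉ F ∧ (∃ v ∈ ends e', Conn ends (fun e => decide (p e = 1)) o v) ∧ p e' ≠ 0 ∧ p e' ≠ 1))
            simp at this
        have hF' : (∀ f ∈ (insert e F), (∃ v ∈ ends f, Conn ends (fun e => decide (p e = 1)) o v) ∧ p f ≠ 0 ∧ p f ≠ 1) := by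
          intro f hf
          rw [Finset.mem_insert] at hf
          rcases hf with rfl | hf
          · exact ⟨heΛ, he0, he1⟩
          · exact hF f hf
        have hC : 0 ≤ r21Anti ends s y o u p (insert e F) := ihn _ hcard' (insert e F) hF' rfl
        have hw0 := hp.nonneg e
        have hw1 := hp.le_one e
        have hw' : 0 ≤ 1 - p e := by linarith
        have e1 : 0 ≤ (1 - p e) ^ 2 * r21Anti ends s y o u (Function.update p e 0) F := mul_nonneg (by positivity) hA
        have e2 : 0 ≤ p e ^ 2 * r21Anti ends s y o u (Function.update p e 1) F := mul_nonneg (by positivity) hB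
        have e3 : 0 ≤ 2 * (p e * (1 - p e)) * r21Anti ends s y o u p (insert e F) :=
          mul_nonneg (mul_nonneg (by norm_num) (mul_nonneg hw0 hw')) hC
        linarith
  intro F hF
  exact key _ F hF rfl

end BernOFrame

end Summit.Ventures.PercRepro2
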